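import Summits.FinalStateConjecture.FinalStateConjecture.Theorems.EIHFluxBalanceInertialRecessionChargeKinematicsIsolated
import Summits.FinalStateConjecture.FinalStateConjecture.Theorems.EIHFluxBalanceInertialRecessionChargeKinematicsPassage
import Mathlib.Topology.MetricSpace.UniformConvergence
import Mathlib.Analysis.Calculus.Deriv.MeanValue

/-!
# Route EIHFluxBalance — `InertialRecession`, line `old-light-leaves-the-cone`: charge kinematics,
# VI (freezing of old relative velocity; anchored paths)

Helper file for the crux `stmt-FinalStateConjecture-10166`
(`Summit.FinalStateConjecture.FinalStateConjecture.Theses.EIHFluxBalance.InertialRecession`), second line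
lead, endgame stub `stub_expandingChargeKinematics` (S4: abstract quasi-conserved window charges with the
slack-form window law and the single-hole identification ⇒ Cesàro velocities of the painted centres).

VI — FREEZING (`pair_freezing`): for an isolated pair, a late relative painted velocity of size `≥ ε₀` never
again leaves the ball of radius `‖vᵢ − vⱼ‖(t₀)/4` about its value — on a first-exit interval the coordinate
along the old relative velocity increases at rate `≥ ε₀/2` (slaving), so the two singleton budgets are a
passage budget `O(m₀^{-3/4}/ε₀ + t₀^{-3/4})` plus slack, eventually `< ε₀/4`. Also: charge convergence along an
anchored cone path (`tendsto_charge_along_anchored_path`) and the uniform-continuity transfer on `‖v‖ ≤ k`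
(`tendsto_sub_comp_of_tendsto_sub`), the two inputs of the tight-pair case.

Every statement is Mathlib-only real analysis over the stub's verbatim hypotheses ([folklore]); the abstract
charge `P` is arbitrary (adversarial), constrained only by the window law and the identification.
-/

set_option linter.dupNamespace false

noncomputable section

open Filter Set Metric Real
open scoped Topology

namespace Summit.FinalStateConjecture.FinalStateConjecture.Theorems.ChargeKinematics

open Literature.Geometry.Lorentzian

/-! ## Freezing: a late, non-small relative velocity of an isolated pair never changes again -/

section Freezing

open MeasureTheory intervalIntegral

variable {N : ℕ} {M : Fin N → ℝ} {ξ v : Fin N → ℝ → E3} {κ : ℝ} {P : ℝ → E3 → ℝ → Fin 4 → ℝ}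

/-- Smallness of the fly-by constants: for `p > 1`, `A · m^{1-p} → 0` as `m → ∞`. [folklore] -/
theorem tendsto_const_mul_rpow_one_sub {p : ℝ} (hp : 1 < p) (A : ℝ) :
    Tendsto (fun m : ℝ ↦ A * m ^ (1 - p)) atTop (𝓝 0) := by
  have h := (tendsto_rpow_neg_atTop (by linarith : 0 < p - 1)).const_mul A
  rw [mul_zero] at h
  refine h.congr fun m ↦ ?_
  rw [show -(p - 1) = 1 - p by ring]

/-- **FREEZING LEMMA (isolated pair).** Under the kinematic clauses, the window law (slack form) and
the identification of `stub_expandingChargeKinematics`, let `i ≠ j` be two holes whose other partners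
recede linearly. For every `ε₀ > 0` there is a time `T_f` such that: if at some `t₀ ≥ T_f` the relative
painted velocity has size `‖vᵢ − vⱼ‖(t₀) ≥ ε₀`, then it never again leaves the ball of radius
`‖vᵢ − vⱼ‖(t₀)/4` about its value at `t₀`. Mechanism: on a first-exit interval the coordinate
`φ = ⟪e, ξᵢ − ξⱼ⟫` along `e ∥ (vᵢ − vⱼ)(t₀)` increases at rate `≥ ε₀/2` (slaving), so by the fly-by
integral the two singleton budgets at the pair radius are `O(m₀^{-3/4}/ε₀ + t₀^{-3/4}) + slack`, smaller
than `ε₀/4` for late `t₀` — contradiction. [folklore] -/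
theorem pair_freezing (hM : ∀ i, 0 < M i) (hκ0 : 0 < κ) (hκ1 : κ < 1)
    (hξ : ∀ i, ContDiff ℝ ((⊤ : ℕ∞) : WithTop ℕ∞) (ξ i))
    (hcone : ∀ i, ∀ᶠ t in atTop, ‖ξ i t‖ ≤ κ ^ 2 * t)
    (hsep : ∀ i j, i ≠ j → Tendsto (fun t ↦ ‖ξ i t - ξ j t‖) atTop atTop)
    (hcont : ∀ i, Continuous (v i))
    (hk : ∃ k : ℝ, 0 ≤ k ∧ k < 1 ∧ ∀ i, ∀ᶠ t in atTop, ‖v i t‖ ≤ k)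
    (hslave : ∀ i, Tendsto (fun t ↦ deriv (ξ i) t - v i t) atTop (𝓝 0))
    (hW : ∀ δ : ℝ, 0 < δ → δ < 1 → ∃ (C R₀ T : ℝ) (η : ℝ → ℝ), Tendsto η atTop (𝓝 0) ∧ ∀ (t₁ t₂ : ℝ) (c : ℝ → E3) (R : ℝ → ℝ), T ≤ t₁ → t₁ ≤ t₂ → (∀ s ∈ Set.Icc t₁ t₂, ∀ s' ∈ Set.Icc t₁ t₂, ‖c s - c s'‖ ≤ 2 * |s - s'| ∧ |R s - R s'| ≤ 2 * |s - s'|) → (∀ s ∈ Set.Icc t₁ t₂, (R₀ ≤ R s ∧ ‖c s‖ + R s ≤ (κ + κ ^ 2) / 2 * s ∧ ∀ j, ‖ξ j s - c s‖ ≤ (1 - δ) * R s ∨ (1 + δ) * R s ≤ ‖ξ j s - c s‖)) → ∀ μ : Fin 4, |P t₂ (c t₂) (R t₂) μ - P t₁ (c t₁) (R t₁) μ| ≤ C * (∫ s in t₁..t₂, ((R s) ^ 2)⁻¹ + ((R s) ^ (7 / 4 : ℝ))⁻¹) + η t₁)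
    (hI : ∃ (C R₀ T : ℝ) (ζ : ℝ → ℝ), Tendsto ζ atTop (𝓝 0) ∧ (∀ (t : ℝ) (i : Fin N) (R : ℝ), T ≤ t → R₀ ≤ R → ‖ξ i t‖ + R ≤ (κ + κ ^ 2) / 2 * t → (∀ j, j ≠ i → 3 * R ≤ ‖ξ i t - ξ j t‖) → |P t (ξ i t) R 0 - M i * (√(1 - ‖v i t‖ ^ 2))⁻¹| ≤ ζ t + C / R ∧ ∀ k : Fin 3, |P t (ξ i t) R k.succ - M i * (√(1 - ‖v i t‖ ^ 2))⁻¹ * v i t k| ≤ ζ t + C / R) ∧ (∀ (t : ℝ) (c : E3) (R : ℝ) (A : Finset (Fin N)) (ρ : Fin N → ℝ), T ≤ t → R₀ ≤ R → ‖c‖ + R ≤ (κ + κ ^ 2) / 2 * t → (∀ j ∈ A, ‖ξ j t - c‖ ≤ R / 2) → (∀ j ∉ A, 2 * R ≤ ‖ξ j t - c‖) → (∀ j ∈ A, R₀ ≤ ρ j ∧ ρ j ≤ R / 4 ∧ ∀ j', j' ≠ j → 3 * ρ j ≤ ‖ξ j t - ξ j' t‖) → ∀ μ : Fin 4, |P t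 c R μ - ∑ j ∈ A, P t (ξ j t) (ρ j) μ| ≤ C * (R⁻¹ + ∑ j ∈ A, (ρ j)⁻¹) + ζ t))
    {i j : Fin N} (hij : i ≠ j) {μ₀ : ℝ} (hμ₀ : 0 < μ₀)
    (hiso : ∀ k, k ≠ i → k ≠ j → ∀ᶠ t in atTop, μ₀ * t ≤ ‖ξ i t - ξ k t‖ ∧ μ₀ * t ≤ ‖ξ j t - ξ k t‖)
    {ε₀ : ℝ} (hε₀ : 0 < ε₀) :
    ∃ Tf : ℝ, ∀ t₀, Tf ≤ t₀ → ε₀ ≤ ‖v i t₀ - v j t₀‖ →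
      ∀ s, t₀ ≤ s → ‖(v i s - v j s) - (v i t₀ - v j t₀)‖ ≤ ‖v i t₀ - v j t₀‖ / 4 := by
  classical
  -- (0) the pair radius and the two singleton laws read at it
  have hκκ : 0 < κ - κ ^ 2 := by nlinarith
  set c₂ : ℝ := min (min ((κ - κ ^ 2) / 2) (μ₀ / 3)) 1 with hc₂def
  have hc₂ : 0 < c₂ := lt_min (lt_min (by linarith) (by linarith)) one_pos
  have hc₂κ : c₂ ≤ (κ - κ ^ 2) / 2 := (min_le_left _ _).trans (min_le_left _ _)
  have hc₂μ : c₂ ≤ μ₀ / 3 := (min_le_left _ _).trans (min_le_right _ _)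
  have hc₂1 : c₂ ≤ 1 := min_le_right _ _
  set R : ℝ → ℝ := fun s ↦ min (‖ξ i s - ξ j s‖ / 3) (c₂ * s) with hRdef
  obtain ⟨TR, hRlip, hRcone, hRsepi, hRsepj, hRinf⟩ :=
    pair_radius hξ hsep hk hslave hij hc₂ hc₂κ hc₂μ hc₂1 hiso
  obtain ⟨Ci, Ti, ei, hCi, hei, hei0, hlawi, hidi, hR1i⟩ :=
    singleton_law hκ0 hκ1 hξ hcone hk hslave hW hI i (R := R) hRlip hRcone hRsepi hRinf
  -- for `j` the same radius works (it is symmetric in `i, j`)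
  obtain ⟨Cj, Tj, ej, hCj, hej, hej0, hlawj, hidj, hR1j⟩ :=
    singleton_law hκ0 hκ1 hξ hcone hk hslave hW hI j (R := R) hRlip hRcone hRsepj hRinf
  clear hW hI hcone hRsepi hRsepj hRcone hRlip
  obtain ⟨k, hk0, hk1, hvk⟩ := hk
  have hdi : Differentiable ℝ (ξ i) := (contDiff_infty_iff_deriv.mp (hξ i)).1
  have hdj : Differentiable ℝ (ξ j) := (contDiff_infty_iff_deriv.mp (hξ j)).1
  have hdci : Continuous (deriv (ξ i)) := (contDiff_infty_iff_deriv.mp (hξ i)).2.continuous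
  have hdcj : Continuous (deriv (ξ j)) := (contDiff_infty_iff_deriv.mp (hξ j)).2.continuous
  -- (1) the target smallness `ε'` and the fly-by constants as functions of the floor `m₀`
  set ε' : ℝ := ε₀ * min (M i) (M j) / 400 with hε'def
  have hMmin : 0 < min (M i) (M j) := lt_min (hM i) (hM j)
  have hε' : 0 < ε' := by positivity
  set g : ℝ := ε₀ / 2 with hgdef
  have hg : 0 < g := by positivity
  -- fly-by constants `F₂(m) = 9·(4 m^{-1}/g)`, `F₇(m) = 3^{7/4}·((14/3)... )`, both `→ 0`
  set F₂ : ℝ → ℝ := fun m ↦ 9 * (2 * 2 * m ^ (1 - 2 : ℝ) / ((2 - 1) * g)) with hF₂def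
  set F₇ : ℝ → ℝ := fun m ↦ (3 : ℝ) ^ (7 / 4 : ℝ) * (2 * (7 / 4) * m ^ (1 - 7 / 4 : ℝ) / ((7 / 4 - 1) * g))
    with hF₇def
  have hF₂t : Tendsto F₂ atTop (𝓝 0) := by
    have := tendsto_const_mul_rpow_one_sub (by norm_num : (1 : ℝ) < 2) (9 * (2 * 2) / ((2 - 1) * g))
    refine this.congr fun m ↦ ?_
    simp only [hF₂def]; ring
  have hF₇t : Tendsto F₇ atTop (𝓝 0) := by
    have := tendsto_const_mul_rpow_one_sub (by norm_num : (1 : ℝ) < 7 / 4)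
      ((3 : ℝ) ^ (7 / 4 : ℝ) * (2 * (7 / 4)) / ((7 / 4 - 1) * g))
    refine this.congr fun m ↦ ?_
    simp only [hF₇def]; ring
  -- choose the floor `m₀ ≥ 1` with `Cmax · F₂(m₀) ≤ ε'` and `Cmax · F₇(m₀) ≤ ε'`
  set Cmax : ℝ := max Ci Cj with hCmaxdef
  have hCmax : 0 ≤ Cmax := hCi.trans (le_max_left _ _)
  have hsmall : ∀ᶠ m in atTop, (Cmax + 1) * F₂ m < ε' ∧ (Cmax + 1) * F₇ m < ε' := by
    have h2 := (hF₂t.const_mul (Cmax + 1)).eventually (gt_mem_nhds (by simpa using hε'))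
    have h7 := (hF₇t.const_mul (Cmax + 1)).eventually (gt_mem_nhds (by simpa using hε'))
    exact h2.and h7
  obtain ⟨m₀, hm₀⟩ := eventually_atTop.mp (hsmall.and (eventually_ge_atTop (1 : ℝ)))
  obtain ⟨⟨hm₀2, hm₀7⟩, hm₀1⟩ := hm₀ m₀ le_rfl
  have hm₀pos : 0 < m₀ := one_pos.trans_le hm₀1
  have hF₂nn : 0 ≤ F₂ m₀ := by simp only [hF₂def]; positivity
  have hF₇nn : 0 ≤ F₇ m₀ := by simp only [hF₇def]; positivity
  -- (2) the late threshold `Tf`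
  have htail : Tendsto (fun t₁ : ℝ ↦ (c₂ ^ 2 * t₁)⁻¹ + 4 / 3 * c₂ ^ (-(7 / 4) : ℝ) * t₁ ^ (-(3 / 4) : ℝ))
      atTop (𝓝 0) := tendsto_budget_bound hc₂
  have hev_tail : ∀ᶠ t in atTop, (Cmax + 1) * ((c₂ ^ 2 * t)⁻¹ +
      4 / 3 * c₂ ^ (-(7 / 4) : ℝ) * t ^ (-(3 / 4) : ℝ)) < ε' :=
    (htail.const_mul (Cmax + 1)).eventually (gt_mem_nhds (by simpa using hε'))
  have hev_ei : ∀ᶠ t in atTop, ei t < ε' := hei.eventually (gt_mem_nhds hε')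
  have hev_ej : ∀ᶠ t in atTop, ej t < ε' := hej.eventually (gt_mem_nhds hε')
  have hev_floor : ∀ᶠ t in atTop, m₀ ≤ ‖ξ i t - ξ j t‖ := (hsep i j hij).eventually_ge_atTop m₀
  have hev_si : ∀ᶠ t in atTop, ‖deriv (ξ i) t - v i t‖ < ε₀ / 8 := by
    have h := (hslave i).norm; rw [norm_zero] at h
    exact h.eventually (gt_mem_nhds (by positivity))
  have hev_sj : ∀ᶠ t in atTop, ‖deriv (ξ j) t - v j t‖ < ε₀ / 8 := by
    have h := (hslave j).norm; rw [norm_zero] at h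
    exact h.eventually (gt_mem_nhds (by positivity))
  obtain ⟨Tf, hTf⟩ := eventually_atTop.mp (hev_tail.and (hev_ei.and (hev_ej.and (hev_floor.and
    (hev_si.and (hev_sj.and ((hvk i).and ((hvk j).and ((eventually_ge_atTop Ti).and
      ((eventually_ge_atTop Tj).and (eventually_ge_atTop (1 : ℝ))))))))))))
  refine ⟨Tf, fun t₀ ht₀ hbig ↦ ?_⟩
  -- (3) fix `t₀`; names
  set r : ℝ → E3 := fun s ↦ v i s - v j s with hrdef
  set ρ : ℝ := ‖r t₀‖ with hρdef
  have hρε : ε₀ ≤ ρ := hbig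
  have hρ : 0 < ρ := hε₀.trans_le hρε
  -- suppose the conclusion fails at some `s₁`; take the first exit time `τ`
  by_contra hcon
  push Not at hcon
  obtain ⟨s₁, hs₁, hbad⟩ := hcon
  have hfc : Continuous fun s ↦ ‖r s - r t₀‖ :=
    ((((hcont i).sub (hcont j)).sub continuous_const)).norm
  obtain ⟨τ, ht₀τ, -, hτeq, hτle⟩ :=
    exists_first_exit (f := fun s ↦ ‖r s - r t₀‖) (a := ρ / 4) hfc (by simp [hρ]) hs₁ hbad.le
  -- facts valid at every `s ≥ t₀ ≥ Tf`
  have hAt : ∀ s, t₀ ≤ s → (Cmax + 1) * ((c₂ ^ 2 * s)⁻¹ +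
      4 / 3 * c₂ ^ (-(7 / 4) : ℝ) * s ^ (-(3 / 4) : ℝ)) < ε' ∧ ei s < ε' ∧ ej s < ε' ∧
      m₀ ≤ ‖ξ i s - ξ j s‖ ∧ ‖deriv (ξ i) s - v i s‖ < ε₀ / 8 ∧ ‖deriv (ξ j) s - v j s‖ < ε₀ / 8 ∧
      ‖v i s‖ ≤ k ∧ ‖v j s‖ ≤ k ∧ Ti ≤ s ∧ Tj ≤ s ∧ 1 ≤ s := fun s hs ↦ hTf s (ht₀.trans hs)
  -- (4) the monotone coordinate `φ = ⟪e, ξ i - ξ j⟫`, `e = ρ⁻¹ r t₀`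
  set e : E3 := ρ⁻¹ • r t₀ with hedef
  have he : ‖e‖ = 1 := by
    rw [hedef, norm_smul, norm_inv, Real.norm_eq_abs, abs_of_pos hρ, hρdef, inv_mul_cancel₀ hρ.ne']
  have her : @inner ℝ E3 _ e (r t₀) = ρ := by
    rw [hedef, real_inner_smul_left, real_inner_self_eq_norm_sq, ← hρdef, sq, ← mul_assoc,
      inv_mul_cancel₀ hρ.ne', one_mul]
  set φ : ℝ → ℝ := fun s ↦ @inner ℝ E3 _ e (ξ i s - ξ j s) with hφdef
  set φ' : ℝ → ℝ := fun s ↦ @inner ℝ E3 _ e (deriv (ξ i) s - deriv (ξ j) s) with hφ'def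
  have hφd : ∀ s, HasDerivAt φ (φ' s) s := fun s ↦ hasDerivAt_inner_sub hdi hdj e s
  have hφ'c : Continuous φ' := continuous_const.inner (hdci.sub hdcj)
  -- on `[t₀, τ]` the coordinate velocity is at least `g = ε₀/2`
  have hmono : ∀ s ∈ Set.Icc t₀ τ, g ≤ φ' s := by
    intro s hs
    obtain ⟨-, -, -, -, hsi, hsj, -⟩ := hAt s hs.1
    have hrs : ‖r s - r t₀‖ ≤ ρ / 4 := hτle s hs
    -- `φ' s = ⟪e, r s⟫ + ⟪e, slaving errors⟫`
    have hsplit : φ' s = @inner ℝ E3 _ e (r t₀) + @inner ℝ E3 _ e (r s - r t₀) +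
        @inner ℝ E3 _ e ((deriv (ξ i) s - v i s) - (deriv (ξ j) s - v j s)) := by
      simp only [hφ'def, hrdef, ← inner_add_right]
      congr 1; abel
    have h1 : |@inner ℝ E3 _ e (r s - r t₀)| ≤ ρ / 4 := (abs_inner_le_norm_of_unit he).trans hrs
    have h2 : |@inner ℝ E3 _ e ((deriv (ξ i) s - v i s) - (deriv (ξ j) s - v j s))| ≤ ε₀ / 4 := by
      refine (abs_inner_le_norm_of_unit he).trans ?_
      refine (norm_sub_le _ _).trans ?_
      linarith [hsi.le, hsj.le]
    rw [hsplit, her]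
    rw [abs_le] at h1 h2
    simp only [hgdef]
    linarith only [h1.1, h2.1, hρε]
  -- (5) the geometric budget on `[t₀, τ]`
  have ht₀pos : 0 < t₀ := one_pos.trans_le (hAt t₀ le_rfl).2.2.2.2.2.2.2.2.2.2
  have hRcont : ContinuousOn R (Set.Icc t₀ τ) := by
    refine Continuous.continuousOn ?_
    simp only [hRdef]
    exact ((hdi.continuous.sub hdj.continuous).norm.div_const 3).min (continuous_const.mul continuous_id)
  have hR1 : ∀ s ∈ Set.Icc t₀ τ, 1 ≤ R s := fun s hs ↦
    (hR1i s ((hAt s hs.1).2.2.2.2.2.2.2.2.1)).1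
  have hRge : ∀ s ∈ Set.Icc t₀ τ, min (max m₀ |φ s| / 3) (c₂ * s) ≤ R s := by
    intro s hs
    obtain ⟨-, -, -, hfl, -⟩ := hAt s hs.1
    have hφle : |φ s| ≤ ‖ξ i s - ξ j s‖ := abs_inner_le_norm_of_unit he
    have hmax : max m₀ |φ s| ≤ ‖ξ i s - ξ j s‖ := max_le hfl hφle
    simp only [hRdef]
    exact min_le_min (by linarith) le_rfl
  have hbudget := passage_budget_le ht₀pos ht₀τ.le hm₀pos hc₂ hg hRcont hR1 hRge hφd hφ'c hmono
  -- (6) the impulse on each hole is at most `7ε'`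
  have hB : ∫ s in t₀..τ, (((R s) ^ 2)⁻¹ + ((R s) ^ (7 / 4 : ℝ))⁻¹) ≤
      F₂ m₀ + F₇ m₀ + ((c₂ ^ 2 * t₀)⁻¹ + 4 / 3 * c₂ ^ (-(7 / 4) : ℝ) * t₀ ^ (-(3 / 4) : ℝ)) := hbudget
  obtain ⟨htail₀, hei₀, hej₀, -, -, -, hvi₀, hvj₀, hTi₀, hTj₀, h1₀⟩ := hAt t₀ le_rfl
  obtain ⟨-, heiτ, hejτ, -, -, -, hviτ, hvjτ, hTiτ, hTjτ, -⟩ := hAt τ ht₀τ.le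
  have htailnn : 0 ≤ (c₂ ^ 2 * t₀)⁻¹ + 4 / 3 * c₂ ^ (-(7 / 4) : ℝ) * t₀ ^ (-(3 / 4) : ℝ) := by positivity
  have hIi : Ci * (∫ s in t₀..τ, (((R s) ^ 2)⁻¹ + ((R s) ^ (7 / 4 : ℝ))⁻¹)) + ei t₀ ≤ 4 * ε' := by
    have h1 : Ci * (∫ s in t₀..τ, (((R s) ^ 2)⁻¹ + ((R s) ^ (7 / 4 : ℝ))⁻¹)) ≤
        Ci * (F₂ m₀ + F₇ m₀ + ((c₂ ^ 2 * t₀)⁻¹ + 4 / 3 * c₂ ^ (-(7 / 4) : ℝ) * t₀ ^ (-(3 / 4) : ℝ))) :=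
      mul_le_mul_of_nonneg_left hB hCi
    have hCle : Ci ≤ Cmax + 1 := (le_max_left _ _).trans (by linarith)
    have h2 : Ci * F₂ m₀ ≤ (Cmax + 1) * F₂ m₀ := mul_le_mul_of_nonneg_right hCle hF₂nn
    have h3 : Ci * F₇ m₀ ≤ (Cmax + 1) * F₇ m₀ := mul_le_mul_of_nonneg_right hCle hF₇nn
    have h4 : Ci * ((c₂ ^ 2 * t₀)⁻¹ + 4 / 3 * c₂ ^ (-(7 / 4) : ℝ) * t₀ ^ (-(3 / 4) : ℝ)) ≤
        (Cmax + 1) * ((c₂ ^ 2 * t₀)⁻¹ + 4 / 3 * c₂ ^ (-(7 / 4) : ℝ) * t₀ ^ (-(3 / 4) : ℝ)) :=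
      mul_le_mul_of_nonneg_right hCle htailnn
    have h5 : Ci * (F₂ m₀ + F₇ m₀ + ((c₂ ^ 2 * t₀)⁻¹ + 4 / 3 * c₂ ^ (-(7 / 4) : ℝ) * t₀ ^ (-(3 / 4) : ℝ))) =
        Ci * F₂ m₀ + Ci * F₇ m₀ +
          Ci * ((c₂ ^ 2 * t₀)⁻¹ + 4 / 3 * c₂ ^ (-(7 / 4) : ℝ) * t₀ ^ (-(3 / 4) : ℝ)) := by ring
    linarith only [h1, h2, h3, h4, h5, hm₀2, hm₀7, htail₀, hei₀]
  have hIj : Cj * (∫ s in t₀..τ, (((R s) ^ 2)⁻¹ + ((R s) ^ (7 / 4 : ℝ))⁻¹)) + ej t₀ ≤ 4 * ε' := by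
    have h1 : Cj * (∫ s in t₀..τ, (((R s) ^ 2)⁻¹ + ((R s) ^ (7 / 4 : ℝ))⁻¹)) ≤
        Cj * (F₂ m₀ + F₇ m₀ + ((c₂ ^ 2 * t₀)⁻¹ + 4 / 3 * c₂ ^ (-(7 / 4) : ℝ) * t₀ ^ (-(3 / 4) : ℝ))) :=
      mul_le_mul_of_nonneg_left hB hCj
    have hCle : Cj ≤ Cmax + 1 := (le_max_right _ _).trans (by linarith)
    have h2 : Cj * F₂ m₀ ≤ (Cmax + 1) * F₂ m₀ := mul_le_mul_of_nonneg_right hCle hF₂nn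
    have h3 : Cj * F₇ m₀ ≤ (Cmax + 1) * F₇ m₀ := mul_le_mul_of_nonneg_right hCle hF₇nn
    have h4 : Cj * ((c₂ ^ 2 * t₀)⁻¹ + 4 / 3 * c₂ ^ (-(7 / 4) : ℝ) * t₀ ^ (-(3 / 4) : ℝ)) ≤
        (Cmax + 1) * ((c₂ ^ 2 * t₀)⁻¹ + 4 / 3 * c₂ ^ (-(7 / 4) : ℝ) * t₀ ^ (-(3 / 4) : ℝ)) :=
      mul_le_mul_of_nonneg_right hCle htailnn
    have h5 : Cj * (F₂ m₀ + F₇ m₀ + ((c₂ ^ 2 * t₀)⁻¹ + 4 / 3 * c₂ ^ (-(7 / 4) : ℝ) * t₀ ^ (-(3 / 4) : ℝ))) =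
        Cj * F₂ m₀ + Cj * F₇ m₀ +
          Cj * ((c₂ ^ 2 * t₀)⁻¹ + 4 / 3 * c₂ ^ (-(7 / 4) : ℝ) * t₀ ^ (-(3 / 4) : ℝ)) := by ring
    linarith only [h1, h2, h3, h4, h5, hm₀2, hm₀7, htail₀, hej₀]
  -- (7) velocity increments of each hole over `[t₀, τ]`
  have hvi : ‖v i τ - v i t₀‖ ≤ 4 * (4 * ε' + ε' + ε') / M i := by
    have := velocity_increment_le (hM i) (hviτ.trans_lt hk1) (hvi₀.trans hk1.le)
      (hidi τ hTiτ) (hidi t₀ hTi₀) (fun μ ↦ (hlawi t₀ τ hTi₀ ht₀τ.le μ).trans hIi)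
    refine this.trans ?_
    gcongr
    · exact (hM i).le
  have hvj : ‖v j τ - v j t₀‖ ≤ 4 * (4 * ε' + ε' + ε') / M j := by
    have := velocity_increment_le (hM j) (hvjτ.trans_lt hk1) (hvj₀.trans hk1.le)
      (hidj τ hTjτ) (hidj t₀ hTj₀) (fun μ ↦ (hlawj t₀ τ hTj₀ ht₀τ.le μ).trans hIj)
    refine this.trans ?_
    gcongr
    · exact (hM j).le
  -- (8) contradiction: `ρ/4 = ‖r τ - r t₀‖ ≤ ‖Δv_i‖ + ‖Δv_j‖ ≤ 48 ε'/M_min = 0.12 ε₀ < ρ/4`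
  have hsum : ‖r τ - r t₀‖ ≤ ‖v i τ - v i t₀‖ + ‖v j τ - v j t₀‖ := by
    have : r τ - r t₀ = (v i τ - v i t₀) - (v j τ - v j t₀) := by simp only [hrdef]; abel
    rw [this]; exact norm_sub_le _ _
  have hMi : 4 * (4 * ε' + ε' + ε') / M i ≤ 24 * ε' / min (M i) (M j) := by
    rw [show 4 * (4 * ε' + ε' + ε') = 24 * ε' by ring]
    exact div_le_div_of_nonneg_left (by positivity) hMmin (min_le_left _ _)
  have hMj : 4 * (4 * ε' + ε' + ε') / M j ≤ 24 * ε' / min (M i) (M j) := by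
    rw [show 4 * (4 * ε' + ε' + ε') = 24 * ε' by ring]
    exact div_le_div_of_nonneg_left (by positivity) hMmin (min_le_right _ _)
  have hfin : 24 * ε' / min (M i) (M j) + 24 * ε' / min (M i) (M j) < ρ / 4 := by
    have : 24 * ε' / min (M i) (M j) = 24 * ε₀ / 400 := by
      simp only [hε'def]
      field_simp
    rw [this]
    linarith
  have hτeq' : ‖r τ - r t₀‖ = ρ / 4 := hτeq
  linarith only [hτeq', hsum, hvi, hvj, hMi, hMj, hfin]

end Freezing

/-! ## Charge convergence along an anchored cone path; uniform-continuity transfer -/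

section AnchoredPath

open MeasureTheory intervalIntegral

variable {N : ℕ} {M : Fin N → ℝ} {ξ v : Fin N → ℝ → E3} {κ : ℝ} {P : ℝ → E3 → ℝ → Fin 4 → ℝ}

/-- **Charge convergence along an anchored cone path.** If after some time the anchored window
`(ξᵢ(s), c₀ s)` (`0 < c₀ ≤ min((κ−κ²)/2, 1)`) is `1/2`-clean (every centre within `c₀s/2` or beyond
`3c₀s/2` of `ξᵢ(s)`), then the four components of `P` along it converge: the budget
`C∫((c₀s)⁻² + (c₀s)^{-7/4}) + η(t₁)` tends to `0`. [folklore] -/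
theorem tendsto_charge_along_anchored_path (hκ0 : 0 < κ) (hκ1 : κ < 1)
    (hξ : ∀ i, ContDiff ℝ ((⊤ : ℕ∞) : WithTop ℕ∞) (ξ i))
    (hcone : ∀ i, ∀ᶠ t in atTop, ‖ξ i t‖ ≤ κ ^ 2 * t)
    (hk : ∃ k : ℝ, 0 ≤ k ∧ k < 1 ∧ ∀ i, ∀ᶠ t in atTop, ‖v i t‖ ≤ k)
    (hslave : ∀ i, Tendsto (fun t ↦ deriv (ξ i) t - v i t) atTop (𝓝 0))
    (hW : ∀ δ : ℝ, 0 < δ → δ < 1 → ∃ (C R₀ T : ℝ) (η : ℝ → ℝ), Tendsto η atTop (𝓝 0) ∧ ∀ (t₁ t₂ : ℝ) (c : ℝ → E3) (R : ℝ → ℝ), T ≤ t₁ → t₁ ≤ t₂ → (∀ s ∈ Set.Icc t₁ t₂, ∀ s' ∈ Set.Icc t₁ t₂, ‖c s - c s'‖ ≤ 2 * |s - s'| ∧ |R s - R s'| ≤ 2 * |s - s'|) → (∀ s ∈ Set.Icc t₁ t₂, (R₀ ≤ R s ∧ ‖c s‖ + R s ≤ (κ + κ ^ 2) / 2 * s ∧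 ∀ j, ‖ξ j s - c s‖ ≤ (1 - δ) * R s ∨ (1 + δ) * R s ≤ ‖ξ j s - c s‖)) → ∀ μ : Fin 4, |P t₂ (c t₂) (R t₂) μ - P t₁ (c t₁) (R t₁) μ| ≤ C * (∫ s in t₁..t₂, ((R s) ^ 2)⁻¹ + ((R s) ^ (7 / 4 : ℝ))⁻¹) + η t₁)
    (i : Fin N) {c₀ Ta : ℝ} (hc₀ : 0 < c₀) (hc₀κ : c₀ ≤ (κ - κ ^ 2) / 2) (hc₀1 : c₀ ≤ 1)
    (hclean : ∀ s, Ta ≤ s → ∀ j, ‖ξ j s - ξ i s‖ ≤ (1 - 1 / 2) * (c₀ * s) ∨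
      (1 + 1 / 2) * (c₀ * s) ≤ ‖ξ j s - ξ i s‖) :
    ∀ μ : Fin 4, ∃ L : ℝ, Tendsto (fun t ↦ P t (ξ i t) (c₀ * t) μ) atTop (𝓝 L) := by
  obtain ⟨C, R₀, T, η, hη, hlaw⟩ := hW (1 / 2) (by norm_num) (by norm_num)
  obtain ⟨k, hk0, hk1, hvk⟩ := hk
  have hdiff : Differentiable ℝ (ξ i) := (contDiff_infty_iff_deriv.mp (hξ i)).1
  obtain ⟨TL, hTL⟩ := exists_forall_norm_sub_le_two_mul hdiff (hslave i) hk1.le (hvk i)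
  have hR₀ : ∀ᶠ t : ℝ in atTop, R₀ ≤ c₀ * t :=
    (tendsto_id.const_mul_atTop hc₀).eventually_ge_atTop R₀
  obtain ⟨T₀, hT₀⟩ := eventually_atTop.mp ((hcone i).and (hR₀.and ((eventually_ge_atTop T).and
    ((eventually_ge_atTop TL).and ((eventually_ge_atTop Ta).and (eventually_ge_atTop (1 : ℝ)))))))
  -- the law along the path
  have hpath : ∀ t₁ t₂, T₀ ≤ t₁ → t₁ ≤ t₂ → ∀ μ, |P t₂ (ξ i t₂) (c₀ * t₂) μ - P t₁ (ξ i t₁) (c₀ * t₁) μ| ≤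
      |C| * ((c₀ ^ 2 * t₁)⁻¹ + 4 / 3 * c₀ ^ (-(7 / 4) : ℝ) * t₁ ^ (-(3 / 4) : ℝ)) + η t₁ := by
    intro t₁ t₂ ht₁ h12 μ
    obtain ⟨-, -, hT1, hTL1, -, h1⟩ := hT₀ t₁ ht₁
    have ht₁pos : 0 < t₁ := by linarith
    have key := hlaw t₁ t₂ (fun s ↦ ξ i s) (fun s ↦ c₀ * s) hT1 h12 ?_ ?_ μ
    · refine key.trans (add_le_add ?_ le_rfl)
      have hint := integral_budget_le hc₀ ht₁pos h12
      have hnn : 0 ≤ ∫ s in t₁..t₂, (((c₀ * s) ^ 2)⁻¹ + ((c₀ * s) ^ (7 / 4 : ℝ))⁻¹) := by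
        apply intervalIntegral.integral_nonneg h12
        intro s hs
        have hs0 : 0 < c₀ * s := mul_pos hc₀ (ht₁pos.trans_le hs.1)
        positivity
      calc C * ∫ s in t₁..t₂, (((c₀ * s) ^ 2)⁻¹ + ((c₀ * s) ^ (7 / 4 : ℝ))⁻¹)
          ≤ |C| * ∫ s in t₁..t₂, (((c₀ * s) ^ 2)⁻¹ + ((c₀ * s) ^ (7 / 4 : ℝ))⁻¹) :=
            mul_le_mul_of_nonneg_right (le_abs_self C) hnn
        _ ≤ |C| * ((c₀ ^ 2 * t₁)⁻¹ + 4 / 3 * c₀ ^ (-(7 / 4) : ℝ) * t₁ ^ (-(3 / 4) : ℝ)) :=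
            mul_le_mul_of_nonneg_left hint (abs_nonneg C)
    · intro s hs s' hs'
      refine ⟨hTL s s' (hTL1.trans hs.1) (hTL1.trans hs'.1), ?_⟩
      rw [← mul_sub, abs_mul, abs_of_pos hc₀]
      exact mul_le_mul_of_nonneg_right (hc₀1.trans (by norm_num)) (abs_nonneg _)
    · intro s hs
      obtain ⟨hcone_s, hR₀s, -, -, hTas, -⟩ := hT₀ s (ht₁.trans hs.1)
      have hs0 : 0 ≤ s := by linarith [hs.1]
      refine ⟨hR₀s, ?_, hclean s hTas⟩
      have : c₀ * s ≤ (κ - κ ^ 2) / 2 * s := mul_le_mul_of_nonneg_right hc₀κ hs0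
      nlinarith
  have hbound : Tendsto (fun t₁ : ℝ ↦ |C| * ((c₀ ^ 2 * t₁)⁻¹ +
      4 / 3 * c₀ ^ (-(7 / 4) : ℝ) * t₁ ^ (-(3 / 4) : ℝ)) + η t₁) atTop (𝓝 0) := by
    have := ((tendsto_budget_bound hc₀).const_mul |C|).add hη
    simpa using this
  intro μ
  apply exists_tendsto_of_abs_sub_le
  intro ε hε
  obtain ⟨T₁, hT₁⟩ := eventually_atTop.mp ((hbound.eventually (gt_mem_nhds hε)).and
    (eventually_ge_atTop T₀))
  refine ⟨T₁, fun t₁ t₂ ht₁ h12 ↦ ?_⟩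
  obtain ⟨hlt, hT₀t⟩ := hT₁ t₁ ht₁
  exact (hpath t₁ t₂ hT₀t h12 μ).trans hlt.le

/-- Transfer of limits along a vanishing difference, through a function uniformly continuous on the
closed ball `‖v‖ ≤ k`: if `G` is continuous on `closedBall 0 k`, both paths stay in it eventually and
`v₁ − v₂ → 0`, then `G ∘ v₁ − G ∘ v₂ → 0`. [folklore] -/
theorem tendsto_sub_comp_of_tendsto_sub {G : E3 → ℝ} {k : ℝ} {v₁ v₂ : ℝ → E3}
    (hG : ContinuousOn G (Metric.closedBall 0 k))
    (h₁ : ∀ᶠ t in atTop, ‖v₁ t‖ ≤ k) (h₂ : ∀ᶠ t in atTop, ‖v₂ t‖ ≤ k)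
    (hsub : Tendsto (fun t ↦ v₁ t - v₂ t) atTop (𝓝 0)) :
    Tendsto (fun t ↦ G (v₁ t) - G (v₂ t)) atTop (𝓝 0) := by
  have huc : UniformContinuousOn G (Metric.closedBall 0 k) :=
    (isCompact_closedBall 0 k).uniformContinuousOn_of_continuous hG
  rw [Metric.uniformContinuousOn_iff] at huc
  rw [Metric.tendsto_nhds]
  intro ε hε
  obtain ⟨δ, hδ, hδε⟩ := huc ε hε
  have hsub' : ∀ᶠ t in atTop, ‖v₁ t - v₂ t‖ < δ := by
    have h := hsub.norm; rw [norm_zero] at h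
    exact h.eventually (gt_mem_nhds hδ)
  filter_upwards [h₁, h₂, hsub'] with t ht₁ ht₂ ht
  rw [Real.dist_eq, sub_zero]
  have := hδε (v₁ t) (mem_closedBall_zero_iff.mpr ht₁) (v₂ t) (mem_closedBall_zero_iff.mpr ht₂)
    (by rwa [dist_eq_norm])
  rwa [Real.dist_eq] at this


end AnchoredPath

end Summit.FinalStateConjecture.FinalStateConjecture.Theorems.ChargeKinematics

namespace Summit.FinalStateConjecture.FinalStateConjecture.Theorems

/-- REGISTERED STUB `pair_freezing` of the crux item stmt-FinalStateConjecture-10166 (second line lead, line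
`old-light-leaves-the-cone`, S4 helper series): the registered one-line signature verbatim, discharged by
`ChargeKinematics.pair_freezing`. [folklore] -/
theorem pair_freezing : open Literature.Geometry.Lorentzian Filter Topology MeasureTheory intervalIntegral in ∀ {N : ℕ} {M : Fin N → ℝ} {ξ v : Fin N → ℝ → E3} {κ : ℝ} {P : ℝ → E3 → ℝ → Fin 4 → ℝ} (hM : ∀ i, 0 < M i) (hκ0 : 0 < κ) (hκ1 : κ < 1) (hξ : ∀ i, ContDiff ℝ ((⊤ : ℕ∞) : WithTop ℕ∞) (ξ i)) (hcone : ∀ i, ∀ᶠ t in atTop, ‖ξ i t‖ ≤ κ ^ 2 * t) (hsep : ∀ i j, i ≠ j → Tendsto (fun t ↦ ‖ξ i t - ξ j t‖) atTop atTop) (hcont : ∀ i, Continuous (v i)) (hk : ∃ k : ℝ, 0 ≤ k ∧ k < 1 ∧ ∀ i, ∀ᶠ t in atTop, ‖v i t‖ ≤ k) (hslave : ∀ i, Tendsto (fun t ↦ deriv (ξ i) t - v i t) atTop (𝓝 0)) (hW : ∀ δ : ℝ, 0 < δ → δ < 1 → ∃ (C R₀ T : ℝ) (η : ℝ → ℝ),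 Tendsto η atTop (𝓝 0) ∧ ∀ (t₁ t₂ : ℝ) (c : ℝ → E3) (R : ℝ → ℝ), T ≤ t₁ → t₁ ≤ t₂ → (∀ s ∈ Set.Icc t₁ t₂, ∀ s' ∈ Set.Icc t₁ t₂, ‖c s - c s'‖ ≤ 2 * |s - s'| ∧ |R s - R s'| ≤ 2 * |s - s'|) → (∀ s ∈ Set.Icc t₁ t₂, (R₀ ≤ R s ∧ ‖c s‖ + R s ≤ (κ + κ ^ 2) / 2 * s ∧ ∀ j, ‖ξ j s - c s‖ ≤ (1 - δ) * R s ∨ (1 + δ) * R s ≤ ‖ξ j s - c s‖)) → ∀ μ : Fin 4, |P t₂ (c t₂) (R t₂) μ - P t₁ (c t₁) (R t₁) μ| ≤ C * (∫ s in t₁..t₂, ((R s) ^ 2)⁻¹ + ((R s) ^ (7 / 4 : ℝ))⁻¹) + η t₁) (hI : ∃ (C R₀ T : ℝ) (ζ : ℝ → ℝ), Tendsto ζ atTop (𝓝 0) ∧ (∀ (t : ℝ) (i : Fin N) (R : ℝ), T ≤ t → R₀ ≤ R → ‖ξ i t‖ + R ≤ (κ + κ ^ 2) / 2 * t → (∀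 j, j ≠ i → 3 * R ≤ ‖ξ i t - ξ j t‖) → |P t (ξ i t) R 0 - M i * (√(1 - ‖v i t‖ ^ 2))⁻¹| ≤ ζ t + C / R ∧ ∀ k : Fin 3, |P t (ξ i t) R k.succ - M i * (√(1 - ‖v i t‖ ^ 2))⁻¹ * v i t k| ≤ ζ t + C / R) ∧ (∀ (t : ℝ) (c : E3) (R : ℝ) (A : Finset (Fin N)) (ρ : Fin N → ℝ), T ≤ t → R₀ ≤ R → ‖c‖ + R ≤ (κ + κ ^ 2) / 2 * t → (∀ j ∈ A, ‖ξ j t - c‖ ≤ R / 2) → (∀ j ∉ A, 2 * R ≤ ‖ξ j t - c‖) → (∀ j ∈ A, R₀ ≤ ρ j ∧ ρ j ≤ R / 4 ∧ ∀ j', j' ≠ j → 3 * ρ j ≤ ‖ξ j t - ξ j' t‖) → ∀ μ : Fin 4, |P t c R μ - ∑ j ∈ A, P t (ξ j t) (ρ j) μ| ≤ C * (R⁻¹ + ∑ j ∈ A, (ρ j)⁻¹) + ζ t)) {i j : Fin N} (hij : i ≠ j) {μ₀ : ℝ} (hμ₀ : 0 < μ₀) (hiso : ∀ k, k ≠ i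 → k ≠ j → ∀ᶠ t in atTop, μ₀ * t ≤ ‖ξ i t - ξ k t‖ ∧ μ₀ * t ≤ ‖ξ j t - ξ k t‖) {ε₀ : ℝ} (hε₀ : 0 < ε₀), ∃ Tf : ℝ, ∀ t₀, Tf ≤ t₀ → ε₀ ≤ ‖v i t₀ - v j t₀‖ → ∀ s, t₀ ≤ s → ‖(v i s - v j s) - (v i t₀ - v j t₀)‖ ≤ ‖v i t₀ - v j t₀‖ / 4 :=
  @ChargeKinematics.pair_freezing

end Summit.FinalStateConjecture.FinalStateConjecture.Theorems

end
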